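import Summits.AnomalousDissipation.AnomalousDissipation.Theses.MarginalStabilityChain
import Literature.Analysis.FluidPDE.StretchedLayerNS

/-!
# Sketch — first lemmas for three crux ideas on `MarginalStabilityChain.StrainedLayerLaw`
(planner crux-ideate, round 1, ideator 2). Statements only (`def … : Prop`); nothing is proved here.

* Idea A `strain-work-sum-rule`: `strainWork`, `excessEnergy`, `ExpTails`, `StrainWorkIdentity`,
  `FloorTransfer`, `CoreWork`.
* Idea B `contraction-capture`: `InClass`, `DenseCellLaw`, `UniqueInClass`, `FinePeriodReduction`,
  `CentroidDecay`, `StrainedCapture`.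
* Idea C `unit-cell-burgers-row-attractor`: `DenseRowSharp`, `SteadySumRule`, `AttractorTransfer`.
-/

noncomputable section

open MeasureTheory Set Filter Topology
open scoped ENNReal
open Literature.Analysis.FluidPDE Literature.Analysis.FluidPDE.StretchedLayer

namespace Summit.AnomalousDissipation.AnomalousDissipation.Cruxes.StrainedLayerLaw.Sketch

/-! ## Idea A — the strain-work sum rule -/

/-- Strain-work functional of a plane slice (`ΔU = 1`): `J(u,v) = ½ ∫_{x∈(0,L]} ∫_y (¼ − u² + v²)`. -/
def strainWork (L : ℝ) (u v : ℝ → ℝ → ℝ) : ℝ :=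
  ∫ x in Ioc 0 L, ∫ y, (1 / 4 - u x y ^ 2 + v x y ^ 2) / 2

/-- Excess planar kinetic energy of a slice relative to the free streams: `E = ½ ∫∫ (u² + v² − ¼)`. -/
def excessEnergy (L : ℝ) (u v : ℝ → ℝ → ℝ) : ℝ :=
  ∫ x in Ioc 0 L, ∫ y, (u x y ^ 2 + v x y ^ 2 - 1 / 4) / 2

/-- Vorticity-moment form of the strain work: `−∫∫ y ω u`, `ω = vₓ − u_y`. -/
def vorticityMomentWork (L : ℝ) (u v : ℝ → ℝ → ℝ) : ℝ :=
  ∫ x in Ioc 0 L, ∫ y, -(y * (dX v x y - dY u x y) * u x y)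

/-- Physical side condition (uniform exponential shear tails on the time set `S`): the deviation
from the free streams, `v`, the velocity gradient, the Laplacian and the time derivative decay like
`e^{−k|y|}`, the pressure is bounded. The intended trajectories (Gaussian tails) satisfy it. -/
def ExpTails (S : Set ℝ) (u v p : ℝ → ℝ → ℝ → ℝ) : Prop :=
  ∃ C k : ℝ, 0 < k ∧ ∀ t ∈ S, ∀ x y : ℝ,
    |u t x y ^ 2 + v t x y ^ 2 - 1 / 4| ≤ C * Real.exp (-k * |y|) ∧
    |v t x y| ≤ C * Real.exp (-k * |y|) ∧ |p t x y| ≤ C ∧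
    |dX (u t) x y| + |dY (u t) x y| + |dX (v t) x y| + |dY (v t) x y| ≤ C * Real.exp (-k * |y|) ∧
    |lap (u t) x y| + |lap (v t) x y| ≤ C * Real.exp (-k * |y|) ∧
    |dT (Ioi 0) u t x y| + |dT (Ioi 0) v t x y| ≤ C * Real.exp (-k * |y|)

/-- **A1 · strain-work identity** (first lemma of idea A). For classical solutions of the stretched
2-D Navier–Stokes class (`γ = ΔU = 1`) with exponential shear tails,
`L ∫_a^b D(t) dt = ∫_a^b J(t) dt − (E(b) − E(a))`: the compressive strain feeds planar energy at
rate `∫∫v²`, the stretching dilutes it at rate `E`, viscosity removes `L·D`; `J = ∫∫v² − E`. -/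
def StrainWorkIdentity : Prop :=
  ∀ ν L a b : ℝ, 0 < ν → 0 < L → 0 < a → a < b →
  ∀ u v p : ℝ → ℝ → ℝ → ℝ,
    IsStretchedLayerNSSolutionOn (Ioi 0) ν 1 1 L u v p → ExpTails (Icc a b) u v p →
    L * ∫ t in a..b, (layerDissipation ν L (u t) (v t)).toReal =
      (∫ t in a..b, strainWork L (u t) (v t)) -
        (excessEnergy L (u b) (v b) - excessEnergy L (u a) (v a))

/-- **A2 · floor transfer**: a time-mean floor on the derivative-free functional `J` plus sublinear
growth of the excess energy gives the dissipation floor of the crux (per unit area, divided by `L`). -/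
def FloorTransfer : Prop :=
  ∀ ν L κ : ℝ, 0 < ν → 0 < L → ∀ u v p : ℝ → ℝ → ℝ → ℝ,
    IsStretchedLayerNSSolutionOn (Ioi 0) ν 1 1 L u v p → (∀ b : ℝ, 1 ≤ b → ExpTails (Icc 1 b) u v p) →
    κ ≤ liminf (fun T : ℝ => T⁻¹ * ∫ t in (1 : ℝ)..T, strainWork L (u t) (v t)) atTop →
    limsup (fun T : ℝ => excessEnergy L (u T) (v T) / T) atTop ≤ 0 →
    (∃ M : ℝ, ∀ T : ℝ, 1 ≤ T → |T⁻¹ * ∫ t in (1 : ℝ)..T, strainWork L (u t) (v t)| ≤ M ∧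
      |excessEnergy L (u T) (v T) / T| ≤ M) →
    ENNReal.ofReal (κ / L) ≤ meanLayerDissipation ν L u v

/-- **A3 · work of the strain on one round core**: for an axisymmetric vorticity profile `w(r)` with
self-induced velocity `u = −y Γ(r)/(2π r²)`, `Γ(r) = 2π∫₀ʳ s w(s) ds`, the functional `−∫∫ y ω u`
equals `Γ(∞)²/(8π)` whatever the size and shape of the profile (`= ½∫ w Γ r dr = ∫ ΓΓ'/(4π)`).
This is the ν-independent Burgers dissipation `γΓ²/8π` read off without derivatives. -/
def CoreWork : Prop :=
  ∀ w : ℝ → ℝ, Continuous w → IntegrableOn (fun s => s * w s) (Ioi 0) →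
    Integrable (fun q : ℝ × ℝ => q.2 ^ 2 * w (Real.sqrt (q.1 ^ 2 + q.2 ^ 2)) *
      (∫ s in (0 : ℝ)..Real.sqrt (q.1 ^ 2 + q.2 ^ 2), s * w s) / (q.1 ^ 2 + q.2 ^ 2)) →
    ∫ q : ℝ × ℝ, q.2 ^ 2 * w (Real.sqrt (q.1 ^ 2 + q.2 ^ 2)) *
        (∫ s in (0 : ℝ)..Real.sqrt (q.1 ^ 2 + q.2 ^ 2), s * w s) / (q.1 ^ 2 + q.2 ^ 2)
      = (2 * Real.pi * ∫ s in Ioi 0, s * w s) ^ 2 / (8 * Real.pi)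

/-! ## Idea B — contraction of the carrier flow, capture of the net circulation, fine period -/

/-- The crux's solution class, verbatim (γ = ΔU = 1, period `L`, datum `U_B^ν + θ`). -/
def InClass (ν L : ℝ) (θ₁ θ₂ : ℝ → ℝ → ℝ) (u v p : ℝ → ℝ → ℝ → ℝ) : Prop :=
  let Dt : (ℝ → ℝ → ℝ → ℝ) → ℝ → ℝ → ℝ → ℝ := fun f t x y => deriv (fun s => f s x y) t
  let Dx : (ℝ → ℝ → ℝ → ℝ) → ℝ → ℝ → ℝ → ℝ := fun f t x y => deriv (fun s => f t s y) x
  let Dy : (ℝ → ℝ → ℝ → ℝ) → ℝ → ℝ → ℝ → ℝ := fun f t x y => deriv (fun s => f t x s) y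
  let UB : ℝ → ℝ := fun y => (Real.sqrt (2 * Real.pi * ν))⁻¹ * ∫ s in (0:ℝ)..y, Real.exp (-(s ^ 2) / (2 * ν))
  ContDiffOn ℝ 2 (fun q : ℝ × ℝ × ℝ => u q.1 q.2.1 q.2.2) (Set.Ioi 0 ×ˢ Set.univ) ∧
  ContDiffOn ℝ 2 (fun q : ℝ × ℝ × ℝ => v q.1 q.2.1 q.2.2) (Set.Ioi 0 ×ˢ Set.univ) ∧
  ContDiffOn ℝ 1 (fun q : ℝ × ℝ × ℝ => p q.1 q.2.1 q.2.2) (Set.Ioi 0 ×ˢ Set.univ) ∧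
  ContinuousOn (fun q : ℝ × ℝ × ℝ => u q.1 q.2.1 q.2.2) (Set.Ici 0 ×ˢ Set.univ) ∧
  ContinuousOn (fun q : ℝ × ℝ × ℝ => v q.1 q.2.1 q.2.2) (Set.Ici 0 ×ˢ Set.univ) ∧
  (∀ t x y, 0 < t → Dt u t x y + u t x y * Dx u t x y + (v t x y - y) * Dy u t x y = -Dx p t x y + ν * (Dx (Dx u) t x y + Dy (Dy u) t x y) ∧ Dt v t x y + u t x y * Dx v t x y + (v t x y - y) * Dy v t x y - v t x y = -Dy p t x y + ν * (Dx (Dx v) t x y + Dy (Dy v) t x y) ∧ Dx u t x y + Dy v t x y = 0) ∧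
  (∀ t x y, 0 ≤ t → u t (x + L) y = u t x y ∧ v t (x + L) y = v t x y ∧ p t (x + L) y = p t x y) ∧
  (∀ t x, 0 ≤ t → Tendsto (fun y => u t x y) atTop (nhds (1 / 2)) ∧ Tendsto (fun y => u t x y) atBot (nhds (-(1 / 2))) ∧ Tendsto (fun y => v t x y) atTop (nhds 0) ∧ Tendsto (fun y => v t x y) atBot (nhds 0)) ∧
  (∀ x y, u 0 x y = UB y + θ₁ x y ∧ v 0 x y = θ₂ x y)

/-- Admissible perturbations of period `L` (verbatim from the crux). -/
def IsAdmissiblePerturbation (L : ℝ) (θ₁ θ₂ : ℝ → ℝ → ℝ) : Prop :=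
  ContDiff ℝ 2 (fun q : ℝ × ℝ => θ₁ q.1 q.2) ∧ ContDiff ℝ 2 (fun q : ℝ × ℝ => θ₂ q.1 q.2) ∧
  (∀ x y, θ₁ (x + L) y = θ₁ x y ∧ θ₂ (x + L) y = θ₂ x y) ∧
  (∃ R : ℝ, ∀ x y, R ≤ |y| → θ₁ x y = 0 ∧ θ₂ x y = 0) ∧
  (∀ x y, deriv (fun s => θ₁ s y) x + deriv (fun s => θ₂ x s) y = 0)

/-- The crux's dissipation per unit area `D(t)` of a slice (verbatim; = `layerDissipation ν L (u t) (v t)`). -/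
def sliceDissipation (ν L : ℝ) (u v : ℝ → ℝ → ℝ → ℝ) (t : ℝ) : ℝ≥0∞ :=
  layerDissipation ν L (u t) (v t)

/-- **Dense-cell law**: the crux restricted to SHORT periods `ℓ ≤ L₀` with the linear constant `c·ℓ`
(one strain-locked core of circulation `ℓ` per period; predicted sharp value `c = 1/8π`). -/
def DenseCellLaw (L₀ c : ℝ) : Prop :=
  ∀ L : ℝ, 0 < L → L ≤ L₀ → ∃ ν₀ : ℝ, 0 < ν₀ ∧ ∃ θ₁ θ₂ : ℝ → ℝ → ℝ, IsAdmissiblePerturbation L θ₁ θ₂ ∧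
    ∀ ν : ℝ, 0 < ν → ν ≤ ν₀ → ∀ u v p : ℝ → ℝ → ℝ → ℝ, InClass ν L θ₁ θ₂ u v p →
      ENNReal.ofReal (c * L) ≤ meanLayerDissipation ν L u v

/-- **Uniqueness in the crux's class** (refuter note M3 made a lemma): two global classical solutions
of period `L` from the same datum `U_B^ν + θ` coincide for `t ≥ 0`. -/
def UniqueInClass : Prop :=
  ∀ ν L : ℝ, 0 < ν → 0 < L → ∀ θ₁ θ₂ : ℝ → ℝ → ℝ, IsAdmissiblePerturbation L θ₁ θ₂ →
    ∀ u v p u' v' p' : ℝ → ℝ → ℝ → ℝ, InClass ν L θ₁ θ₂ u v p → InClass ν L θ₁ θ₂ u' v' p' →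
      ∀ t x y, 0 ≤ t → u t x y = u' t x y ∧ v t x y = v' t x y

/-- **B1 · fine-period reduction** (first lemma of idea B): an `ℓ`-periodic `θ` with `ℓ = L/n` is
`L`-periodic; by uniqueness every `L`-periodic solution from it is `ℓ`-periodic (compare with its
`ℓ`-translate), its dissipation per unit area over period `L` equals that over period `ℓ`, and
`c·ℓ ≥ c·min(1, L₀/2)·min(L,1)` for `ℓ = L/⌈L/L₀⌉`. Hence the dense-cell law implies the crux. -/
def FinePeriodReduction : Prop :=
  UniqueInClass → (∃ L₀ c : ℝ, 0 < L₀ ∧ 0 < c ∧ DenseCellLaw L₀ c) →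
    Summit.AnomalousDissipation.AnomalousDissipation.Theses.MarginalStabilityChain.StrainedLayerLaw

/-- **B2 · decay of the vorticity centroid** (the translation mode is damped by the compression):
`∫∫ y ω (b) = e^{−(b−a)} ∫∫ y ω (a)` along classical solutions with shear tails
(`d/dt ∫∫yω = ∫∫ω(v − y) = −∫∫yω` since `∫∫ωv = 0`). -/
def CentroidDecay : Prop :=
  ∀ ν L a b : ℝ, 0 < ν → 0 < L → 0 < a → a ≤ b → ∀ u v p : ℝ → ℝ → ℝ → ℝ,
    IsStretchedLayerNSSolutionOn (Ioi 0) ν 1 1 L u v p → ExpTails (Icc a b) u v p →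
    (∀ t ∈ Icc a b, ∃ C k : ℝ, 0 < k ∧ ∀ x y, |y * (dX (v t) x y - dY (u t) x y)| ≤ C * Real.exp (-k * |y|)) →
    (∫ x in Ioc 0 L, ∫ y, y * (dX (v b) x y - dY (u b) x y)) =
      Real.exp (-(b - a)) * ∫ x in Ioc 0 L, ∫ y, y * (dX (v a) x y - dY (u a) x y)

/-- **B3 · capture by a point vortex in plane strain** (exact monotonicity): in the planar field of a
point vortex of strength `κ` at the origin plus the compression `(0, −y)` — tracer: `κ = Γ/2π`; HALF
separation of two like-signed vortices `Γ`: `κ = Γ/4π` — the motion `ẋ = −κy/r²`, `ẏ = κx/r² − y`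
satisfies `d(r²)/dt = −2y² ≤ 0`, and `r → 0`: every fluid particle spirals into the vortex, two
like-signed strained vortices always merge (there are no equilibria and no closed orbits; if
`r → r∞ > 0` then `y → 0`, `|x| → r∞`, `ẏ → ±κ/r∞ ≠ 0`, contradiction). -/
def StrainedCapture : Prop :=
  ∀ κ : ℝ, κ ≠ 0 → ∀ x y : ℝ → ℝ,
    (∀ t : ℝ, 0 ≤ t → 0 < x t ^ 2 + y t ^ 2 ∧
      HasDerivAt x (-(κ * y t) / (x t ^ 2 + y t ^ 2)) t ∧
      HasDerivAt y (κ * x t / (x t ^ 2 + y t ^ 2) - y t) t) →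
    AntitoneOn (fun t => x t ^ 2 + y t ^ 2) (Ici 0) ∧
      Tendsto (fun t => x t ^ 2 + y t ^ 2) atTop (nhds 0)

/-! ## Idea C — the dense steady Burgers row as a ν-uniform attractor -/

/-- **C1 · sharp dense steady row** (construction half): for short periods `ℓ` and small `ν` there
is a steady `ℓ`-periodic solution of the stretched class whose dissipation per unit area is
`ℓ/(8π)` up to `ε` — one Burgers core of circulation `ℓ` per period, the value forced by the
steady sum rule `ℓ·D = J` and `J(core) = Γ²/8π`. Sharp dense form of `StretchedVortexRows`. -/
def DenseRowSharp : Prop :=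
  ∀ ε : ℝ, 0 < ε → ∃ L₀ : ℝ, 0 < L₀ ∧ ∀ ℓ : ℝ, 0 < ℓ → ℓ ≤ L₀ → ∃ ν₀ : ℝ, 0 < ν₀ ∧
    ∀ ν : ℝ, 0 < ν → ν ≤ ν₀ → ∃ u v p : ℝ → ℝ → ℝ,
      IsSteadyStretchedLayerNSSolution ν 1 1 ℓ u v p ∧
      ENNReal.ofReal ((1 - ε) * ℓ / (8 * Real.pi)) ≤ layerDissipation ν ℓ u v ∧
      layerDissipation ν ℓ u v ≤ ENNReal.ofReal ((1 + ε) * ℓ / (8 * Real.pi))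

/-- **C2 · steady sum rule**: for a steady solution with exponential shear tails the dissipation per
unit area is the derivative-free strain work: `ℓ · D = J = ½∫∫(¼ − u² + v²)`. -/
def SteadySumRule : Prop :=
  ∀ ν ℓ : ℝ, 0 < ν → 0 < ℓ → ∀ u v p : ℝ → ℝ → ℝ, IsSteadyStretchedLayerNSSolution ν 1 1 ℓ u v p →
    ExpTails univ (fun _ => u) (fun _ => v) (fun _ => p) →
    ℓ * (layerDissipation ν ℓ u v).toReal = strainWork ℓ u v ∧ layerDissipation ν ℓ u v ≠ ⊤

/-- **C3 · attractor transfer** (Cesàro): if the slice dissipation of a global solution converges to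
that of a steady state, the crux's liminf time-mean equals the steady value. -/
def AttractorTransfer : Prop :=
  ∀ ν L : ℝ, 0 < ν → 0 < L → ∀ (u v : ℝ → ℝ → ℝ → ℝ) (uS vS : ℝ → ℝ → ℝ),
    layerDissipation ν L uS vS ≠ ⊤ →
    Tendsto (fun t => layerDissipation ν L (u t) (v t)) atTop (nhds (layerDissipation ν L uS vS)) →
    (∀ T : ℝ, 0 < T → ∫⁻ t in Ioc 0 T, layerDissipation ν L (u t) (v t) ≠ ⊤) →
    meanLayerDissipation ν L u v = layerDissipation ν L uS vS

end Summit.AnomalousDissipation.AnomalousDissipation.Cruxes.StrainedLayerLaw.Sketch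

end
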